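import Summits.QuantumFields.YangMills.Theorems.BalabanUVNodesN07Lemma1CrossingFlat
import Summits.QuantumFields.YangMills.Theorems.BalabanUVNodesN07Lemma1CrossingBonds
import HarnessLib

/-!
# DAG node N07 [B11] — Sect. F (160) CASE II ASSEMBLED: Lemma 1 of [6] (1.25) for EVERY far-face crossing bond in the (0.4) reading, `SU(N)`, and at the
# record (`Node00.avOfRecord`) — the two halves `…N07Lemma1CrossingFlat` (p607031: `U(Γ ∪ [x,x′] ∪ (−Γ′))` is `(dist1 (Ū c) + 7t)`-small) and
# `…N07Lemma1CrossingBonds` (every crossing bond ≤ that transporter + `(d+1)(L−1)τ`) put together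

Cell `pub-ymgap` (HUMAN RULINGS D-0062 ∕ D-0149 ∕ D-0154), width seat `pub-ymgap-dag-n07-w5` g0, 2026-08-28.  `--kind proof --supports
stmt-QuantumFields-20542 --as helper` (K1⁷; count-neutral helper on the N07 [B11] row; dag-lead WIDTH-209 N07 piece 1b, DEDUP-382; third file of this seat).

THE PRINT.  [6] = T. Bałaban, CMP **99** (1985) 75–102 `[Balaban1985RegularSpaces]`, Lemma 1 (1.24)–(1.25) p. 79 «|V′ − 1| < 4d²α₀ + α₁ on Ω₁», proof
p. 79 l. −6 – p. 80 l. 4; [B11] = T. Bałaban, CMP **102** (1985) 277–309 `[Balaban1985Variational]`, (160) p. 303 second case «The lemma implies that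
|V₁(x₁, x′₁) − 1| < 4d²L²ε₁ + |x − y|2L²ε₁ for ⟨x₁, x′₁⟩ ⊂ B(x) ∪ B(x′), hence |B(x₁, x′₁)| < 8d²L²ε₁ + |x − y|4L²ε₁»; [I] = T. Bałaban, CMP **109** (1987)
249–301 `[Balaban1987RG1]`, (0.4) p. 253 (the averaging of record); [B7] = CMP **98** (1985) 17–51 `[Balaban1985Averaging]`, (11) p. 19 (covariance).

WHAT THIS FILE DOES (kernel bookkeeping; every estimate is a tree theorem cited by name; nothing of [B11] ∕ [6] beyond Lemma 1's elementary step asserted).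
* ★★★ `dist1_crossingBond_le_avg_add` (`SU(N)`, generic torus, standing range): fine plaquettes based in `B(c₋ − e_μ) ∪ B(c₋) ∪ B(c₊)` within `a` of `1`,
  `t := ((d+2)L)²∕4·a < δ_N`, bonds inside `B(c₋)`, `B(c₊)` `τ`-close to `1` ⇒ for every `x = blockSite c₋ r` on the far face (`r_μ = L − 1`):
  `dist1 (U⟨x, μ⟩) ≤ dist1 (Ū(c)) + 7t + (d+1)(L−1)·τ`, `Ū = avgFun expMeanLogSU U` — (1.25) with `α₁ = dist1 (Ū(c))` and the tree's `7t + (d+1)(L−1)τ` for `4d²α₀`.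
* ★★ `norm_datum_crossingBond_le` — the log-datum shape (print's «|B(x₁, x′₁)| < 8d²L²ε₁ + |x − y|4L²ε₁»; `C = 2`, `ρ = ½` for `(1∕i) log`,
  `B11Eq160BondField.norm_fieldB_le`).
* `avg_gaugeAct_eq_of_apply_emb_eq_one` — a FINE gauge transformation trivial at the block centres does not move the averaged data (covariance (11) at
  `Node00.avOfRecord`): the block-wise gauge fixing that produces `τ` keeps the coarse smallness `α` delivered by p607031 `exists_dataAxialStep`.
* ★★★ `dist1_crossingBond_le_at_record` — at `Node00.avOfRecord F N K j`: `dist1 (M(W)(c)) ≤ α` + the local hypotheses ⇒ every far-face crossing bond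
  `≤ α + 7t + (d+1)(L−1)τ`.

HONEST FRAMING (binding).  Count-neutral helper; by-name composition of p607031 + `…CrossingBonds` + [B7] Prop. 1's local correction-factor bound; the
smallnesses `a` (plaquettes), `τ` (within-block bonds, block-wise axial gauge = the consumer's, pv26 per block) and `α` (coarse data, p607031 §5) are
HYPOTHESES; the interior bonds, the far-field (155) and the Landau `u` ∕ its shear ((156), GAP-STATED(avg-universality)) are NOT here; constants are the
tree's crude ones.  Tokens ∕ stub 1 ∕ K0⁷ ∕ K1⁷ NOT closed; N07 NOT discharged (5∕27 unmoved); one finite `T⁴` programme at fixed `ε`, Bałaban AS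
PRINTED — R4 closes rung `BalabanLadder.UV` only; no summit statement is proved by this seat; NOT continuum ∕ ℝ⁴ ∕ OS ∕ mass gap ∕ Clay.  No `sorry`, no
`def`, no `instance`, no `notation`.
-/

noncomputable section

namespace Summit.QuantumFields.YangMills.BalabanUVNodes.N07Lemma1CrossingBondsAtRecord

open Literature.MathematicalPhysics.QuantumFieldTheory.Balaban1983to89
open T4Continuum AveragingRT BlockAveraging
open BlockAveragingHaarAC (openHol)
open N07Lemma1CrossingBonds (dist1_crossingBond_le_openHol_add)

/-! ## §1  Every far-face crossing bond under a smallness of the AVERAGE, `SU(N)`; §2 at the record -/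

section SUN

open scoped Matrix.Norms.L2Operator
open ExpMeanLog
open N07Lemma1CrossingFlat (dist1_openHol_le_of_plaqSmallOn_blocks)

variable {n : Type*} [Fintype n] [DecidableEq n] [Nonempty n] {P : Params} {j : ℕ}

/-- ★★★ **LEMMA 1 OF [6] (1.25) FOR THE (0.4) AVERAGING, every far-face crossing bond, `SU(N)`**: if the fine plaquettes based in
`B(c₋ − e_μ) ∪ B(c₋) ∪ B(c₊)` are within `a` of `1`, `t := ((d+2)L)²∕4·a < δ_N`, and the bonds inside `B(c₋)`, `B(c₊)` are `τ`-close to `1`, then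
for every `x = blockSite c₋ r` on the far face (`r_μ = L − 1`):
`dist1 (U⟨x, μ⟩) ≤ dist1 (Ū(c)) + 7t + (d + 1)(L − 1)·τ`, `Ū = avgFun expMeanLogSU U` — print's «|V′ − 1| < 4d²α₀ + α₁» with `α₁ = dist1 (Ū(c))` and
the tree's `7t + (d+1)(L−1)τ` for `4d²α₀` (first half: p607031 `dist1_openHol_le_of_plaqSmallOn_blocks`).
[cite: Balaban1985RegularSpaces, Lemma 1 (1.24)-(1.25) p.79, p.80 l.1-4; Balaban1987RG1, (0.4) p.253] -/
theorem dist1_crossingBond_le_avg_add {a : ℝ} (ha : 0 ≤ a) (hj : j + 1 ≤ P.m + P.K)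
    {U : GaugeField P j (Matrix.specialUnitaryGroup n ℂ)} (c : PBond P (j + 1))
    (hU : ∀ q : Plaq P j, (blockOf q.src = c.src.unshift c.dir ∨ blockOf q.src = c.src ∨ blockOf q.src = c.tgt) →
      dist1 (GaugeField.plaqHol U q) < a)
    (ht : ((((P.d + 2) * P.L : ℕ) : ℝ) ^ 2 / 4) * a < deltaSU n)
    {τ : ℝ} (hτ : 0 ≤ τ)
    (hint : ∀ b : PBond P j, blockOf b.src = blockOf b.tgt → (blockOf b.src = c.src ∨ blockOf b.src = c.tgt) → dist1 (U b) ≤ τ)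
    (r : Fin P.d → Fin P.L) (hr : (r c.dir : ℕ) = P.L - 1) (σ σ' : Equiv.Perm (Fin P.d)) :
    dist1 (U ⟨Site.blockSite c.src r, c.dir⟩) ≤
      dist1 (avgFun (expMeanLogSU (n := n)) U c) + 7 * (((((P.d + 2) * P.L : ℕ) : ℝ) ^ 2 / 4) * a) +
        (((P.d + 1) * (P.L - 1) : ℕ) : ℝ) * τ := by
  have h₁ := dist1_crossingBond_le_openHol_add hj U c r hr σ σ' hτ hint
  have h₂ := dist1_openHol_le_of_plaqSmallOn_blocks ha hj c hU ht (r, σ, σ')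
  linarith

/-- ★★ **THE SAME IN LOG-DATUM SHAPE** ([B11] (160) p.303 second case «hence |B(x₁, x′₁)| < 8d²L²ε₁ + |x − y|4L²ε₁»): for a log-like
`β` with `‖β g‖ ≤ C·dist1 g` on `dist1 g ≤ ρ` (the principal logarithm: `C = 2`, `ρ = ½`, `B11Eq160BondField.norm_fieldB_le`), the datum of every far-face
crossing bond obeys `‖β(U⟨x, μ⟩)‖ ≤ C·(dist1 (Ū c) + 7t + (d+1)(L−1)τ)` once that bound is `≤ ρ`. [cite: Balaban1985Variational, (160) p.303] -/
theorem norm_datum_crossingBond_le {E : Type*} [SeminormedAddCommGroup E] (β : Matrix.specialUnitaryGroup n ℂ → E) {C ρ : ℝ} (hC : 0 ≤ C)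
    (hβ : ∀ g : Matrix.specialUnitaryGroup n ℂ, dist1 g ≤ ρ → ‖β g‖ ≤ C * dist1 g)
    {a : ℝ} (ha : 0 ≤ a) (hj : j + 1 ≤ P.m + P.K)
    {U : GaugeField P j (Matrix.specialUnitaryGroup n ℂ)} (c : PBond P (j + 1))
    (hU : ∀ q : Plaq P j, (blockOf q.src = c.src.unshift c.dir ∨ blockOf q.src = c.src ∨ blockOf q.src = c.tgt) →
      dist1 (GaugeField.plaqHol U q) < a)
    (ht : ((((P.d + 2) * P.L : ℕ) : ℝ) ^ 2 / 4) * a < deltaSU n)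
    {τ : ℝ} (hτ : 0 ≤ τ)
    (hint : ∀ b : PBond P j, blockOf b.src = blockOf b.tgt → (blockOf b.src = c.src ∨ blockOf b.src = c.tgt) → dist1 (U b) ≤ τ)
    (r : Fin P.d → Fin P.L) (hr : (r c.dir : ℕ) = P.L - 1) (σ σ' : Equiv.Perm (Fin P.d))
    (hρ : dist1 (avgFun (expMeanLogSU (n := n)) U c) + 7 * (((((P.d + 2) * P.L : ℕ) : ℝ) ^ 2 / 4) * a) +
        (((P.d + 1) * (P.L - 1) : ℕ) : ℝ) * τ ≤ ρ) :
    ‖β (U ⟨Site.blockSite c.src r, c.dir⟩)‖ ≤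
      C * (dist1 (avgFun (expMeanLogSU (n := n)) U c) + 7 * (((((P.d + 2) * P.L : ℕ) : ℝ) ^ 2 / 4) * a) +
        (((P.d + 1) * (P.L - 1) : ℕ) : ℝ) * τ) := by
  have hd := dist1_crossingBond_le_avg_add ha hj c hU ht hτ hint r hr σ σ'
  exact (hβ _ (hd.trans hρ)).trans (mul_le_mul_of_nonneg_left hd hC)

end SUN

section Record

open scoped Matrix.Norms.L2Operator
open ExpMeanLog
open Node00 (avOfRecord avOfRecord_avg)

variable {F : T4Family} {N : ℕ} [NeZero N] {K j : ℕ}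

/-- **A FINE gauge transformation trivial at the block centres does not move the averaged data** (covariance (11): `M(W^g) = M(W)^{g∘emb} = M(W)`)
— so the within-block gauge fixing the consumer performs to get `τ` keeps the coarse smallness `α` of `M(W)` delivered by p607031 §5.
[cite: Balaban1985Averaging, (11) p.19; Balaban1985RegularSpaces, (1.14) p.78] -/
theorem avg_gaugeAct_eq_of_apply_emb_eq_one (hj : j + 1 ≤ (F.P K).m + (F.P K).K) (g : GaugeTransf (F.P K) j (Node00.SU N))
    (hg : ∀ y : Site (F.P K) (j + 1), g (emb y) = 1) (W : GaugeField (F.P K) j (Node00.SU N)) :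
    (avOfRecord F N K j).avg (GaugeField.gaugeAct g W) = (avOfRecord F N K j).avg W := by
  rw [avOfRecord_avg, avgFun_covariant _ hj]
  funext c
  simp only [GaugeField.gaugeAct, hg, one_mul, inv_one, mul_one]

/-- ★★★ **[B11] (160) CASE II AT THE RECORD, bond by bond on the far face**: for a fine field `W` on `T^{(j)}` of the torus `F.P K` whose averaged
data `M(W)` (`Node00.avOfRecord`) is `α`-small on the coarse bond `c` (p607031 `exists_dataAxialStep` supplies `α = (d−1)nδ̄` on the box bonds after
the coarse axial re-gauging; `avg_gaugeAct_eq_of_apply_emb_eq_one` keeps it under the fine block-wise gauge), whose fine plaquettes near `c` are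
`a`-small and whose bonds inside `B(c₋)`, `B(c₊)` are `τ`-small: every far-face crossing bond has `dist1 ≤ α + 7t + (d+1)(L−1)τ`.
[cite: Balaban1985Variational, (160) p.303; Balaban1985RegularSpaces, Lemma 1 (1.25) p.79] -/
theorem dist1_crossingBond_le_at_record (hj : j + 1 ≤ (F.P K).m + (F.P K).K) {a α τ : ℝ} (ha : 0 ≤ a) (hτ : 0 ≤ τ)
    {W : GaugeField (F.P K) j (Node00.SU N)} (c : PBond (F.P K) (j + 1))
    (hW : ∀ q : Plaq (F.P K) j, (blockOf q.src = c.src.unshift c.dir ∨ blockOf q.src = c.src ∨ blockOf q.src = c.tgt) →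
      dist1 (GaugeField.plaqHol W q) < a)
    (ht : (((((F.P K).d + 2) * (F.P K).L : ℕ) : ℝ) ^ 2 / 4) * a < deltaSU (Fin N))
    (hα : dist1 ((avOfRecord F N K j).avg W c) ≤ α)
    (hint : ∀ b : PBond (F.P K) j, blockOf b.src = blockOf b.tgt → (blockOf b.src = c.src ∨ blockOf b.src = c.tgt) → dist1 (W b) ≤ τ)
    (r : Fin (F.P K).d → Fin (F.P K).L) (hr : (r c.dir : ℕ) = (F.P K).L - 1) (σ σ' : Equiv.Perm (Fin (F.P K).d)) :
    dist1 (W ⟨Site.blockSite c.src r, c.dir⟩) ≤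
      α + 7 * ((((((F.P K).d + 2) * (F.P K).L : ℕ) : ℝ) ^ 2 / 4) * a) + ((((F.P K).d + 1) * ((F.P K).L - 1) : ℕ) : ℝ) * τ := by
  have h := dist1_crossingBond_le_avg_add ha hj c hW ht hτ hint r hr σ σ'
  rw [avOfRecord_avg] at hα
  linarith

end Record


end Summit.QuantumFields.YangMills.BalabanUVNodes.N07Lemma1CrossingBondsAtRecord

end
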